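import Summits.Ventures.Crystal3D.Theorems.StickyWulffConstantTextureLiminfL12Local
import HarnessLib

/-!
# Stub closers `stub_gap`, `stub_classification` of the registered skeleton 'CoaxialWallLawCertificates' (crux `CoaxialWallLaw`, stmt-Ventures-19481)

HONEST FRAMING. Venture `Summits/Ventures/Crystal3D` (cell `crystal3d-full`); `--supports` the crux `CoaxialWallLaw` (stmt-Ventures-19481,
`route-Ventures-StickyWulffConstant`), registered line 'CoaxialWallLawCertificates' (cf-p1, 2026-08-29T04:21:53Z).  Closes the stubs
`stub_gap : KissingGap (5/2)` and `stub_classification : KissingClassification (5/2)` BY NAME with the tree theorems `kissingGap_250`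
(`…TextureLiminfL12Local`, from `CapX2.noHole_0625`) and `kissingClassification_250` (`Kissing125`), both of computational grade.  Nothing new
is proved (cf-p1 04:22:11Z: «the three computational tree facts can be closed by one-line files»; `stub_starFar` landed as p698360).
-/

namespace Summit.Ventures.Crystal3D.Cruxes.CoaxialWallLaw.Certificates

/-- **Stub closer**: `KissingGap (5/2)` (tree theorem `kissingGap_250`, computational grade). -/
theorem stub_gap : Summit.Ventures.Crystal3D.KissingGap (5 / 2) :=
  Summit.Ventures.Crystal3D.Theorems.kissingGap_250

/-- **Stub closer**: `KissingClassification (5/2)` (tree theorem `kissingClassification_250`, computational grade). -/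
theorem stub_classification : Summit.Ventures.Crystal3D.KissingClassification (5 / 2) :=
  Summit.Ventures.Crystal3D.kissingClassification_250

end Summit.Ventures.Crystal3D.Cruxes.CoaxialWallLaw.Certificates
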